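/-
Copyright (c) 2026 the pub-hodgecm-mathlib formalisation cell (harness21).  Prover seat hodgecm-mathlib-B-p14 (g36): road «S3-tree» (LEAD F0P3a-plan (g11), architect A-p16 (g29)),
brick T1e «VALENCIES OF THE `U(3)` LATTICE TREE», FILE V1 = THE STARS (structure + transport); 2026-09-01.  Sequel of the T1 chain of B-p14 (g35)
(★ `UnitaryLatticeTreeDefs` … ★ `UnitaryLatticeTreeTypeTwoTransitive`).
-/
import Literature.NumberTheory.Automorphic.UnitaryLatticeTreeTypeTwoTransitive   -- ★ T1d′ (B-p14 (g35)): `exists_mapGL_N₁_eq_of_isVertexLattice_two`; brings the T1 cone (Types, Dual, Apartment, SelfDualFrames, IsTree)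
import HarnessLib

/-!
# The lattice graph of a hermitian space — T1e FILE V1: THE STAR OF A VERTEX of the `U(3)` tree (a self-dual vertex is maximal, a type-two vertex minimal; the two
# stars as sets of lattices; every star is a `U(J₀)`-translate of the star of `L₀ = 𝒪³` or of `N₁ = latt diag(1,1,ϖ)`) (Bruhat–Tits 1972 §10; Serre, *Trees* II.1.1)

Topic `NumberTheory/Automorphic`; namespace `Literature.NumberTheory.Automorphic.UnitaryLatticeTree`.  THEOREMS ONLY (no definition, no instance, no notation, no named fact,
no `sorry`); kernel lane.  Cell `pub/hodgecm-mathlib` (D-0151), crux H413 = `stmt-HodgeConjecture-24833`; road «S3-tree», brick **T1e «VALENCIES»**: the bi-regular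
`(q³+1, q+1)` numbers of the Bruhat–Tits tree of the unramified `U(3)` in the T1a lattice model, consumed BY NAME by the T2-S fold (F0P2-p02 (g10) hand-over memo
`HANDOFF-T2S-fold` §2 (b)) through ★ `TreeDisplacementLayerCount` ED. 2 (F0P3a-p08 (g17): hypotheses `(G.neighborSet v).Finite` and `(G.neighborSet v).ncard = q (c v) + 1`).
THIS FILE (V1, any residue field) isolates the STAR of a vertex as a set of lattices and moves it to the two standard vertices; FILE V2 counts the star of `L₀`
(`q³ + 1`), FILE V3 the star of `N₁` (`q + 1`).

THE MATHEMATICS (`K` with `Valued K ℤᵐ⁰`, `hd : UnramifiedLocalConjDatum σ ϖ`, `J₀ = antidiag(1,1,1)`, `G = latticeGraph σ ϖ J₀` on the vertices `{M // IsVertex σ ϖ J₀ M}`;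
adjacency = STRICT CONTAINMENT either way, ★ `latticeGraph_adj_iff`).
(§1) A SELF-DUAL vertex `L` is MAXIMAL among vertex lattices (any `N`, any invertible `H`): `L ≤ M ⇒ M ≤ M^♯ ≤ L^♯ = L` (★ `le_dualLatt_of_isVertexLattice`, ★ `dualLatt_antitone`,
★ `dualLatt_eq_self_of_isSelfDualLattice`).  At `N = 3` the types are `0` and `2` (★ `type_eq_zero_or_two_of_isVertexLattice_three`) and comparable vertices of the same type are
equal (★ `eq_of_le_of_isVertexLattice`), so for vertices `M < M′`: `M` is of type `2` and `M′` is self-dual; a type-two vertex is NOT self-dual (the type is read in any basis,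
★ `vertexTriple_of_latt_eq`).  Hence (§2) the STAR of a self-dual `v` is `{w | w.1 < v.1}` (all of type `2`), the star of a type-two `v` is `{w | v.1 < w.1}` (all self-dual),
and the types ALTERNATE along edges (the `hc` of ★ `TreeLayers.ncard_layer_succ_inter_type_eq`).  (§3) `U(J₀)` acts by graph automorphisms (★ `latticeGraphIso`), so
`neighborSet` is transported by `SimpleGraph.Iso.mapNeighborSet` (same `ncard`, same finiteness); every self-dual vertex is `u·L₀` (★ `exists_frame_three_of_isSelfDualLattice` +
the torus element ★ `exists_coe_eq_diagonal_zpow`) and every type-two vertex is `u·N₁` (★ T1d′ `exists_mapGL_N₁_eq_of_isVertexLattice_two`), `u ∈ U(J₀)`: the valency of a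
vertex depends only on its type and equals that of `L₀` resp. `N₁` (§4).

* §1 `le_of_isSelfDualLattice_of_le`, `not_lt_of_isSelfDualLattice` (any `N`); `isVertexLattice_two_and_isSelfDualLattice_of_lt`, `not_isSelfDualLattice_of_isVertexLattice_two` (`N = 3`).
* §2 `latticeGraph_adj_iff_lt_of_isSelfDualLattice`, `latticeGraph_adj_iff_gt_of_isVertexLattice_two`, `isVertexLattice_two_of_adj_of_isSelfDualLattice`,
  `isSelfDualLattice_of_adj_of_isVertexLattice_two`, **`neighborSet_eq_of_isSelfDualLattice`**, **`neighborSet_eq_of_isVertexLattice_two`**,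
  **`isSelfDualLattice_iff_not_isSelfDualLattice_of_adj`** (types alternate).
* §3 `latticeGraphIso_apply_val`, **`ncard_neighborSet_latticeGraphIso`**, **`finite_neighborSet_latticeGraphIso_iff`** (any `N`, any `H`); `exists_eq_mapGL_stdLattice_of_isSelfDualLattice`,
  `exists_latticeGraphIso_root_eq`, `exists_latticeGraphIso_N₁_eq` (`N = 3`).
* §4 **`ncard_neighborSet_eq_ncard_neighborSet_root`** ∕ **`finite_neighborSet_iff_root`** (self-dual `v`), **`ncard_neighborSet_eq_ncard_neighborSet_N₁`** ∕
  **`finite_neighborSet_iff_N₁`** (type-two `v`); `mem_neighborSet_root_iff`, `mem_neighborSet_N₁_iff` (the two standard stars as sets of lattices).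

HONEST LABEL: HC_CM is proved only modulo the 2 remaining named inputs (hLiu418 24832, h413 24833) until rung 0 closes; nothing printed is asserted here (elementary lattice
algebra over a valuation ring); S3 (`stub_N6nsS3id`) stays a print row until the road's END lands.

## References
* [BruhatTits1972] F. Bruhat, J. Tits, *Groupes réductifs sur un corps local I*, Publ. Math. IHÉS 41 (1972), §10 (rank one: the building is a tree; lattice models).
* [Tits1979] J. Tits, *Reductive groups over local fields*, PSPM 33.1 (1979), §3.5 (the star of a vertex = the residual building), §2.4 (quasi-split `U(3)`).
* [Serre1980Trees] J.-P. Serre, *Trees* (1980), Ch. II §1.1 (the tree of `SL₂`: neighbours of a lattice, homogeneity under the group).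
* [Jacobowitz1962] R. Jacobowitz, *Hermitian forms over local fields*, Amer. J. Math. 84 (1962), §7–§8 (unimodular and modular hermitian lattices).
-/

set_option autoImplicit false

noncomputable section

open scoped Valued WithZero Matrix MatrixGroups

namespace Literature.NumberTheory.Automorphic.UnitaryLatticeTree

open Literature.NumberTheory.Automorphic Literature.NumberTheory.Automorphic.HermitianLattice
open Literature.NumberTheory.Automorphic.CartanUnique

variable {K : Type*} [Field K] [Valued K ℤᵐ⁰] {σ : K →+* K} {ϖ : K} {N : ℕ}

/-! ## §1 A self-dual vertex is maximal; comparable vertices at `N = 3` -/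

/-- **A self-dual vertex is MAXIMAL among vertex lattices**: `L` self-dual, `M` a vertex of any type, `L ≤ M` ⇒ `M ≤ L` (`M ≤ M^♯ ≤ L^♯ = L`; `H` invertible, `σ`
valuation-preserving). [cite: Jacobowitz1962, §7–§8] [cite: BruhatTits1972, §10] -/
theorem le_of_isSelfDualLattice_of_le (hvσ : ∀ a, Valued.v (σ a) = Valued.v a) {H : Matrix (Fin N) (Fin N) K} (hH : IsUnit H.det)
    {L M : Submodule 𝒪[K] (Fin N → K)} (hL : IsSelfDualLattice σ ϖ H L) {d : ℕ} (hM : IsVertexLattice σ ϖ H d M) (h : L ≤ M) : M ≤ L :=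
  calc M ≤ dualLatt σ H M := le_dualLatt_of_isVertexLattice hvσ hM
    _ ≤ dualLatt σ H L := dualLatt_antitone σ H h
    _ = L := dualLatt_eq_self_of_isSelfDualLattice hvσ hH hL

/-- No vertex lies strictly above a self-dual vertex. [cite: Jacobowitz1962, §7–§8] [cite: BruhatTits1972, §10] -/
theorem not_lt_of_isSelfDualLattice (hvσ : ∀ a, Valued.v (σ a) = Valued.v a) {H : Matrix (Fin N) (Fin N) K} (hH : IsUnit H.det)
    {L M : Submodule 𝒪[K] (Fin N → K)} (hL : IsSelfDualLattice σ ϖ H L) (hM : IsVertex σ ϖ H M) : ¬ L < M := by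
  intro hlt
  obtain ⟨d, hdM⟩ := hM
  exact hlt.ne (le_antisymm hlt.le (le_of_isSelfDualLattice_of_le hvσ hH hL hdM hlt.le))

section Three

/-- **At `N = 3`, of two comparable distinct vertices the smaller is of type `2` and the larger is self-dual** (`hd : UnramifiedLocalConjDatum σ ϖ`): types are `0` or `2`,
a self-dual vertex is maximal, and comparable vertices of the same type coincide. [cite: BruhatTits1972, §10] [cite: Serre1980Trees, II.1.1] -/
theorem isVertexLattice_two_and_isSelfDualLattice_of_lt (hd : UnramifiedLocalConjDatum σ ϖ) {M M' : Submodule 𝒪[K] (Fin 3 → K)}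
    (hM : IsVertex σ ϖ ((StdForm.antidiagonal 3).over K) M) (hM' : IsVertex σ ϖ ((StdForm.antidiagonal 3).over K) M') (h : M < M') :
    IsVertexLattice σ ϖ ((StdForm.antidiagonal 3).over K) 2 M ∧ IsSelfDualLattice σ ϖ ((StdForm.antidiagonal 3).over K) M' := by
  have hϖ0 : ϖ ≠ 0 := uniformizer_ne_zero hd.vϖ
  obtain ⟨d, hdM⟩ := hM
  obtain ⟨d', hdM'⟩ := hM'
  rcases type_eq_zero_or_two_of_isVertexLattice_three hd.vσ hd.vϖ v_det_antidiagonal_three hdM with rfl | rfl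
  · exact absurd h (not_lt_of_isSelfDualLattice hd.vσ isUnit_det_antidiagonal hdM ⟨d', hdM'⟩)
  · rcases type_eq_zero_or_two_of_isVertexLattice_three hd.vσ hd.vϖ v_det_antidiagonal_three hdM' with rfl | rfl
    · exact ⟨hdM, hdM'⟩
    · exact absurd (eq_of_le_of_isVertexLattice hd.vσ hϖ0 hdM hdM' h.le) h.ne

/-- **A type-two vertex is not self-dual** (the type `|det Gram| = |ϖ|^d` is read in ANY basis, ★ `vertexTriple_of_latt_eq`, and `|ϖ|² ≠ 1`). [cite: Jacobowitz1962, §7–§8] -/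
theorem not_isSelfDualLattice_of_isVertexLattice_two (hd : UnramifiedLocalConjDatum σ ϖ) {M : Submodule 𝒪[K] (Fin N → K)} {H : Matrix (Fin N) (Fin N) K}
    (hM : IsVertexLattice σ ϖ H 2 M) : ¬ IsSelfDualLattice σ ϖ H M := by
  intro h0
  obtain ⟨g, rfl, -, -, hdet2⟩ := hM
  obtain ⟨-, -, hdet0⟩ := vertexTriple_of_latt_eq (ϖ := ϖ) hd.vσ h0
  rw [hdet0, pow_zero, hd.vϖ, ← WithZero.exp_nsmul, ← WithZero.exp_zero, WithZero.exp_inj] at hdet2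
  norm_num at hdet2

/-! ## §2 The star of a vertex, by type; types alternate along edges -/

/-- **Adjacency at a self-dual vertex**: `v ~ w ↔ w.1 < v.1`. [cite: BruhatTits1972, §10] [cite: Serre1980Trees, II.1.1] -/
theorem latticeGraph_adj_iff_lt_of_isSelfDualLattice (hd : UnramifiedLocalConjDatum σ ϖ)
    {v w : {M : Submodule 𝒪[K] (Fin 3 → K) // IsVertex σ ϖ ((StdForm.antidiagonal 3).over K) M}}
    (hv : IsSelfDualLattice σ ϖ ((StdForm.antidiagonal 3).over K) v.1) :
    (latticeGraph σ ϖ ((StdForm.antidiagonal 3).over K)).Adj v w ↔ w.1 < v.1 := by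
  rw [latticeGraph_adj_iff]
  constructor
  · rintro (h | h)
    · exact absurd h (not_lt_of_isSelfDualLattice hd.vσ isUnit_det_antidiagonal hv w.2)
    · exact h
  · exact Or.inr

/-- The neighbours of a self-dual vertex are of type `2`. [cite: BruhatTits1972, §10] -/
theorem isVertexLattice_two_of_adj_of_isSelfDualLattice (hd : UnramifiedLocalConjDatum σ ϖ)
    {v w : {M : Submodule 𝒪[K] (Fin 3 → K) // IsVertex σ ϖ ((StdForm.antidiagonal 3).over K) M}}
    (hv : IsSelfDualLattice σ ϖ ((StdForm.antidiagonal 3).over K) v.1) (h : (latticeGraph σ ϖ ((StdForm.antidiagonal 3).over K)).Adj v w) :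
    IsVertexLattice σ ϖ ((StdForm.antidiagonal 3).over K) 2 w.1 :=
  (isVertexLattice_two_and_isSelfDualLattice_of_lt hd w.2 v.2 ((latticeGraph_adj_iff_lt_of_isSelfDualLattice hd hv).1 h)).1

/-- **Adjacency at a type-two vertex**: `v ~ w ↔ v.1 < w.1`. [cite: BruhatTits1972, §10] [cite: Serre1980Trees, II.1.1] -/
theorem latticeGraph_adj_iff_gt_of_isVertexLattice_two (hd : UnramifiedLocalConjDatum σ ϖ)
    {v w : {M : Submodule 𝒪[K] (Fin 3 → K) // IsVertex σ ϖ ((StdForm.antidiagonal 3).over K) M}}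
    (hv : IsVertexLattice σ ϖ ((StdForm.antidiagonal 3).over K) 2 v.1) :
    (latticeGraph σ ϖ ((StdForm.antidiagonal 3).over K)).Adj v w ↔ v.1 < w.1 := by
  rw [latticeGraph_adj_iff]
  constructor
  · rintro (h | h)
    · exact h
    · exact absurd (isVertexLattice_two_and_isSelfDualLattice_of_lt hd w.2 v.2 h).2 (not_isSelfDualLattice_of_isVertexLattice_two hd hv)
  · exact Or.inl

/-- The neighbours of a type-two vertex are self-dual. [cite: BruhatTits1972, §10] -/
theorem isSelfDualLattice_of_adj_of_isVertexLattice_two (hd : UnramifiedLocalConjDatum σ ϖ)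
    {v w : {M : Submodule 𝒪[K] (Fin 3 → K) // IsVertex σ ϖ ((StdForm.antidiagonal 3).over K) M}}
    (hv : IsVertexLattice σ ϖ ((StdForm.antidiagonal 3).over K) 2 v.1) (h : (latticeGraph σ ϖ ((StdForm.antidiagonal 3).over K)).Adj v w) :
    IsSelfDualLattice σ ϖ ((StdForm.antidiagonal 3).over K) w.1 :=
  (isVertexLattice_two_and_isSelfDualLattice_of_lt hd v.2 w.2 ((latticeGraph_adj_iff_gt_of_isVertexLattice_two hd hv).1 h)).2

/-- **THE STAR OF A SELF-DUAL VERTEX** is the set of vertices strictly below it. [cite: BruhatTits1972, §10] [cite: Tits1979, §3.5] -/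
theorem neighborSet_eq_of_isSelfDualLattice (hd : UnramifiedLocalConjDatum σ ϖ)
    {v : {M : Submodule 𝒪[K] (Fin 3 → K) // IsVertex σ ϖ ((StdForm.antidiagonal 3).over K) M}}
    (hv : IsSelfDualLattice σ ϖ ((StdForm.antidiagonal 3).over K) v.1) :
    (latticeGraph σ ϖ ((StdForm.antidiagonal 3).over K)).neighborSet v = {w | w.1 < v.1} :=
  Set.ext fun _ => latticeGraph_adj_iff_lt_of_isSelfDualLattice hd hv

/-- **THE STAR OF A TYPE-TWO VERTEX** is the set of vertices strictly above it. [cite: BruhatTits1972, §10] [cite: Tits1979, §3.5] -/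
theorem neighborSet_eq_of_isVertexLattice_two (hd : UnramifiedLocalConjDatum σ ϖ)
    {v : {M : Submodule 𝒪[K] (Fin 3 → K) // IsVertex σ ϖ ((StdForm.antidiagonal 3).over K) M}}
    (hv : IsVertexLattice σ ϖ ((StdForm.antidiagonal 3).over K) 2 v.1) :
    (latticeGraph σ ϖ ((StdForm.antidiagonal 3).over K)).neighborSet v = {w | v.1 < w.1} :=
  Set.ext fun _ => latticeGraph_adj_iff_gt_of_isVertexLattice_two hd hv

/-- **TYPES ALTERNATE ALONG EDGES**: for adjacent `v, w` exactly one is self-dual — the hypothesis `hc` («`c v ≠ c w`») of ★ `TreeLayers.ncard_layer_succ_inter_type_eq` for the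
type function of the `U(3)` tree. [cite: BruhatTits1972, §10] [cite: Serre1980Trees, I.2.3] -/
theorem isSelfDualLattice_iff_not_isSelfDualLattice_of_adj (hd : UnramifiedLocalConjDatum σ ϖ)
    {v w : {M : Submodule 𝒪[K] (Fin 3 → K) // IsVertex σ ϖ ((StdForm.antidiagonal 3).over K) M}}
    (h : (latticeGraph σ ϖ ((StdForm.antidiagonal 3).over K)).Adj v w) :
    IsSelfDualLattice σ ϖ ((StdForm.antidiagonal 3).over K) v.1 ↔ ¬ IsSelfDualLattice σ ϖ ((StdForm.antidiagonal 3).over K) w.1 := by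
  obtain ⟨d, hdv⟩ := v.2
  rcases type_eq_zero_or_two_of_isVertexLattice_three hd.vσ hd.vϖ v_det_antidiagonal_three hdv with rfl | rfl
  · exact ⟨fun hv => not_isSelfDualLattice_of_isVertexLattice_two hd (isVertexLattice_two_of_adj_of_isSelfDualLattice hd hv h), fun _ => hdv⟩
  · constructor
    · exact fun hv => absurd hv (not_isSelfDualLattice_of_isVertexLattice_two hd hdv)
    · exact fun hw => absurd (isSelfDualLattice_of_adj_of_isVertexLattice_two hd hdv h) hw

end Three

/-! ## §3 Transport of stars along `U(σ, H)`; the two standard vertices -/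

/-- The action on underlying lattices, `mapGL` spelling: `(latticeGraphIso u v).1 = u · v.1`. [cite: BruhatTits1972, §10] -/
theorem latticeGraphIso_apply_val {H : Matrix (Fin N) (Fin N) K} (u : unitaryGroupOfForm σ H) (v : {M : Submodule 𝒪[K] (Fin N → K) // IsVertex σ ϖ H M}) :
    (latticeGraphIso σ ϖ H u v).1 = mapGL (u : GL (Fin N) K) v.1 := rfl

/-- **Stars are transported by the action**: `#star(u·v) = #star(v)` (as `Set.ncard`; any `N`, any `H`). [cite: BruhatTits1972, §10] [cite: Serre1980Trees, II.1.1] -/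
theorem ncard_neighborSet_latticeGraphIso {H : Matrix (Fin N) (Fin N) K} (u : unitaryGroupOfForm σ H) (v : {M : Submodule 𝒪[K] (Fin N → K) // IsVertex σ ϖ H M}) :
    ((latticeGraph σ ϖ H).neighborSet (latticeGraphIso σ ϖ H u v)).ncard = ((latticeGraph σ ϖ H).neighborSet v).ncard := by
  rw [← Nat.card_coe_set_eq, ← Nat.card_coe_set_eq]
  exact (Nat.card_congr ((latticeGraphIso σ ϖ H u).mapNeighborSet v)).symm

/-- Finiteness of stars is transported by the action. [cite: BruhatTits1972, §10] -/
theorem finite_neighborSet_latticeGraphIso_iff {H : Matrix (Fin N) (Fin N) K} (u : unitaryGroupOfForm σ H) (v : {M : Submodule 𝒪[K] (Fin N → K) // IsVertex σ ϖ H M}) :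
    ((latticeGraph σ ϖ H).neighborSet (latticeGraphIso σ ϖ H u v)).Finite ↔ ((latticeGraph σ ϖ H).neighborSet v).Finite := by
  rw [← Set.finite_coe_iff, ← Set.finite_coe_iff]
  exact ⟨fun h => Finite.of_equiv _ ((latticeGraphIso σ ϖ H u).mapNeighborSet v).symm, fun h => Finite.of_equiv _ ((latticeGraphIso σ ϖ H u).mapNeighborSet v)⟩

section Three

/-- **Every self-dual vertex of `(K³, J₀)` is `u·L₀`** for some `u ∈ U(J₀)` (`L₀ = 𝒪³`): the frame ★ `exists_frame_three_of_isSelfDualLattice` gives `k·L_a`, `k ∈ K₀`, and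
`L_a = t_a·L₀` for the torus element `t_a = diag(ϖ^a, 1, ϖ^{−a})` (★ `exists_coe_eq_diagonal_zpow`). [cite: BruhatTits1972, §10] [cite: Tits1979, §3.3.3] -/
theorem exists_eq_mapGL_stdLattice_of_isSelfDualLattice (hd : UnramifiedLocalConjDatum σ ϖ) {M : Submodule 𝒪[K] (Fin 3 → K)}
    (hM : IsSelfDualLattice σ ϖ ((StdForm.antidiagonal 3).over K) M) :
    ∃ u : unitaryGroupOfForm σ ((StdForm.antidiagonal 3).over K), M = mapGL (u : GL (Fin 3) K) (stdLattice K 3) := by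
  have hϖ0 : ϖ ≠ 0 := uniformizer_ne_zero hd.vϖ
  obtain ⟨k, -, a, rfl⟩ := exists_frame_three_of_isSelfDualLattice hd hM
  obtain ⟨t, ht⟩ := exists_coe_eq_diagonal_zpow hd.σσ hd.σϖ hϖ0 a
  refine ⟨k * t, ?_⟩
  rw [Subgroup.coe_mul, mapGL_mul, ← latt_one, mapGL_coe_latt_eq t ht, Matrix.mul_one]

/-- The root `L₀ = 𝒪³` reaches every self-dual vertex under `U(J₀)`, vertex form. [cite: BruhatTits1972, §10] [cite: Tits1979, §3.3.3] -/
theorem exists_latticeGraphIso_root_eq (hd : UnramifiedLocalConjDatum σ ϖ)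
    (v : {M : Submodule 𝒪[K] (Fin 3 → K) // IsVertex σ ϖ ((StdForm.antidiagonal 3).over K) M}) (hv : IsSelfDualLattice σ ϖ ((StdForm.antidiagonal 3).over K) v.1) :
    ∃ u : unitaryGroupOfForm σ ((StdForm.antidiagonal 3).over K),
      latticeGraphIso σ ϖ ((StdForm.antidiagonal 3).over K) u ⟨stdLattice K 3, 0, isSelfDualLattice_stdLattice_three hd⟩ = v := by
  obtain ⟨u, hu⟩ := exists_eq_mapGL_stdLattice_of_isSelfDualLattice hd hv
  exact ⟨u, Subtype.ext (by rw [latticeGraphIso_apply_val]; exact hu.symm)⟩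

/-- The standard type-two vertex `N₁ = latt diag(1,1,ϖ)` reaches every type-two vertex under `U(J₀)`, vertex form (★ T1d′). [cite: BruhatTits1972, §10] [cite: Jacobowitz1962, §7] -/
theorem exists_latticeGraphIso_N₁_eq (hd : UnramifiedLocalConjDatum σ ϖ)
    (v : {M : Submodule 𝒪[K] (Fin 3 → K) // IsVertex σ ϖ ((StdForm.antidiagonal 3).over K) M}) (hv : IsVertexLattice σ ϖ ((StdForm.antidiagonal 3).over K) 2 v.1) :
    ∃ u : unitaryGroupOfForm σ ((StdForm.antidiagonal 3).over K),
      latticeGraphIso σ ϖ ((StdForm.antidiagonal 3).over K) u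
        ⟨latt (Matrix.diagonal ![(1 : K), 1, ϖ]), 2,
          isVertexLattice_two_latt_diagonal_one_one hd.σϖ (uniformizer_mem_integer hd.vϖ) (uniformizer_ne_zero hd.vϖ)⟩ = v := by
  obtain ⟨u, hu⟩ := exists_mapGL_N₁_eq_of_isVertexLattice_two hd hv
  exact ⟨u, Subtype.ext (by rw [latticeGraphIso_apply_val]; exact hu.symm)⟩

/-! ## §4 The valency depends only on the type; the two standard stars as sets of lattices -/

/-- **The star of a self-dual vertex has the cardinality of the star of the root `L₀`.** [cite: BruhatTits1972, §10] [cite: Serre1980Trees, II.1.1] -/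
theorem ncard_neighborSet_eq_ncard_neighborSet_root (hd : UnramifiedLocalConjDatum σ ϖ)
    (v : {M : Submodule 𝒪[K] (Fin 3 → K) // IsVertex σ ϖ ((StdForm.antidiagonal 3).over K) M}) (hv : IsSelfDualLattice σ ϖ ((StdForm.antidiagonal 3).over K) v.1) :
    ((latticeGraph σ ϖ ((StdForm.antidiagonal 3).over K)).neighborSet v).ncard =
      ((latticeGraph σ ϖ ((StdForm.antidiagonal 3).over K)).neighborSet ⟨stdLattice K 3, 0, isSelfDualLattice_stdLattice_three hd⟩).ncard := by
  obtain ⟨u, rfl⟩ := exists_latticeGraphIso_root_eq hd v hv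
  exact ncard_neighborSet_latticeGraphIso u _

/-- Finiteness of the star of a self-dual vertex ↔ finiteness of the star of the root. [cite: BruhatTits1972, §10] -/
theorem finite_neighborSet_iff_root (hd : UnramifiedLocalConjDatum σ ϖ)
    (v : {M : Submodule 𝒪[K] (Fin 3 → K) // IsVertex σ ϖ ((StdForm.antidiagonal 3).over K) M}) (hv : IsSelfDualLattice σ ϖ ((StdForm.antidiagonal 3).over K) v.1) :
    ((latticeGraph σ ϖ ((StdForm.antidiagonal 3).over K)).neighborSet v).Finite ↔
      ((latticeGraph σ ϖ ((StdForm.antidiagonal 3).over K)).neighborSet ⟨stdLattice K 3, 0, isSelfDualLattice_stdLattice_three hd⟩).Finite := by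
  obtain ⟨u, rfl⟩ := exists_latticeGraphIso_root_eq hd v hv
  exact finite_neighborSet_latticeGraphIso_iff u _

/-- **The star of a type-two vertex has the cardinality of the star of `N₁`.** [cite: BruhatTits1972, §10] [cite: Serre1980Trees, II.1.1] -/
theorem ncard_neighborSet_eq_ncard_neighborSet_N₁ (hd : UnramifiedLocalConjDatum σ ϖ)
    (v : {M : Submodule 𝒪[K] (Fin 3 → K) // IsVertex σ ϖ ((StdForm.antidiagonal 3).over K) M}) (hv : IsVertexLattice σ ϖ ((StdForm.antidiagonal 3).over K) 2 v.1) :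
    ((latticeGraph σ ϖ ((StdForm.antidiagonal 3).over K)).neighborSet v).ncard =
      ((latticeGraph σ ϖ ((StdForm.antidiagonal 3).over K)).neighborSet
        ⟨latt (Matrix.diagonal ![(1 : K), 1, ϖ]), 2,
          isVertexLattice_two_latt_diagonal_one_one hd.σϖ (uniformizer_mem_integer hd.vϖ) (uniformizer_ne_zero hd.vϖ)⟩).ncard := by
  obtain ⟨u, rfl⟩ := exists_latticeGraphIso_N₁_eq hd v hv
  exact ncard_neighborSet_latticeGraphIso u _

/-- Finiteness of the star of a type-two vertex ↔ finiteness of the star of `N₁`. [cite: BruhatTits1972, §10] -/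
theorem finite_neighborSet_iff_N₁ (hd : UnramifiedLocalConjDatum σ ϖ)
    (v : {M : Submodule 𝒪[K] (Fin 3 → K) // IsVertex σ ϖ ((StdForm.antidiagonal 3).over K) M}) (hv : IsVertexLattice σ ϖ ((StdForm.antidiagonal 3).over K) 2 v.1) :
    ((latticeGraph σ ϖ ((StdForm.antidiagonal 3).over K)).neighborSet v).Finite ↔
      ((latticeGraph σ ϖ ((StdForm.antidiagonal 3).over K)).neighborSet
        ⟨latt (Matrix.diagonal ![(1 : K), 1, ϖ]), 2,
          isVertexLattice_two_latt_diagonal_one_one hd.σϖ (uniformizer_mem_integer hd.vϖ) (uniformizer_ne_zero hd.vϖ)⟩).Finite := by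
  obtain ⟨u, rfl⟩ := exists_latticeGraphIso_N₁_eq hd v hv
  exact finite_neighborSet_latticeGraphIso_iff u _

/-- **The star of the root as a set of lattices**: `w ∈ star(L₀) ↔ w.1 < 𝒪³` (and then `w.1` is of type `2`). [cite: BruhatTits1972, §10] [cite: Serre1980Trees, II.1.1] -/
theorem mem_neighborSet_root_iff (hd : UnramifiedLocalConjDatum σ ϖ)
    (w : {M : Submodule 𝒪[K] (Fin 3 → K) // IsVertex σ ϖ ((StdForm.antidiagonal 3).over K) M}) :
    w ∈ (latticeGraph σ ϖ ((StdForm.antidiagonal 3).over K)).neighborSet ⟨stdLattice K 3, 0, isSelfDualLattice_stdLattice_three hd⟩ ↔ w.1 < stdLattice K 3 :=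
  latticeGraph_adj_iff_lt_of_isSelfDualLattice hd (isSelfDualLattice_stdLattice_three hd)

/-- **The star of `N₁` as a set of lattices**: `w ∈ star(N₁) ↔ N₁ < w.1` (and then `w.1` is self-dual). [cite: BruhatTits1972, §10] [cite: Serre1980Trees, II.1.1] -/
theorem mem_neighborSet_N₁_iff (hd : UnramifiedLocalConjDatum σ ϖ)
    (w : {M : Submodule 𝒪[K] (Fin 3 → K) // IsVertex σ ϖ ((StdForm.antidiagonal 3).over K) M}) :
    w ∈ (latticeGraph σ ϖ ((StdForm.antidiagonal 3).over K)).neighborSet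
        ⟨latt (Matrix.diagonal ![(1 : K), 1, ϖ]), 2,
          isVertexLattice_two_latt_diagonal_one_one hd.σϖ (uniformizer_mem_integer hd.vϖ) (uniformizer_ne_zero hd.vϖ)⟩ ↔
      latt (Matrix.diagonal ![(1 : K), 1, ϖ]) < w.1 :=
  latticeGraph_adj_iff_gt_of_isVertexLattice_two hd
    (isVertexLattice_two_latt_diagonal_one_one hd.σϖ (uniformizer_mem_integer hd.vϖ) (uniformizer_ne_zero hd.vϖ))

end Three

end Literature.NumberTheory.Automorphic.UnitaryLatticeTree

end
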